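import Literature.Probability.Percolation.QuadCrossingSpace
import Literature.Topology.PlaneTopology.BandCrossing
import HarnessLib

/-!
# A crossing destroyed by changing a small ball leaves two arms around the ball

Topic `Literature/Probability/Percolation`; proofs file next to `QuadCrossingSpace.lean` (quads `Q`,
crossings `Q.IsCrossing K`), towards the discrete gluing Theorem 1.1 of O. Schramm, S. Smirnov,
*On the scaling limits of planar percolation*, Ann. Probab. 39 (2011), arXiv:1101.5820, §2:
"In order for `{ω_{j-1} ∈ ⊞_{Q₀}} ∩ {ω_j ∉ ⊞_{Q₀}}` to hold, there must be a crossing in `ω_{j-1}`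
from `∂₀Q₀` to `∂₂Q₀` that goes through `B_j` … Thus, in `ω_j` we have the four arm event from
`∂B_j` to `∂Q₀`" (the two configurations agree off the ball `B_j = B(w_j, 2s)`).  For bond
percolation on `ℤ²` the four-arm estimate is available in CLUSTER form
(`Garban2011_fourArm_multiscale`, `FourArmGarban.lean`: two open crossings of an annulus lying in
distinct open clusters of the annulus), so only the two OPEN arms and their non-connectability are
needed; this file proves that continuum statement, configuration-free (the open edges of the two
configurations enter only through the sets `O₁ ⊇ K` and `O₂ ⊇ K ∖ B(w, ρ)`):

* `exists_mem_connectedComponentIn_level` — **boundary bumping for a level set**: if a continuum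
  `K` meets `{φ < ρ}` (`φ` continuous) and `x ∈ K` has `φ x ≥ ρ`, then the connected component of
  `x` in `K ∩ {φ ≥ ρ}` reaches the level `{φ = ρ}` (cut-wire theorem
  `exists_isClopen_superset_disjoint` of `BandCrossing.lean` in the compact space `K ∩ {φ ≥ ρ}`);
* `Quad.exists_two_arms_of_isCrossing` — **two arms**: if `K` is a crossing of `Q` with
  `K ∖ B(w, ρ) ⊆ O₂`, no crossing of `Q` lies inside `O₂`, and the sides `∂₀Q`, `∂₂Q` stay at
  distance `> R ≥ ρ` from `w`, then there are continua `C₀ ∋ x₀ ∈ ∂₀Q`, `C₂ ∋ x₂ ∈ ∂₂Q` inside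
  `K ∖ B(w, ρ)` (hence inside `O₂`), each meeting the circle `|z - w| = ρ` and the exterior
  `|z - w| > R` — two crossings of the annulus `A(w; ρ, R)` inside `O₂` — such that **no continuum
  `L ⊆ [Q] ∩ O₂` meets both** (else `C₀ ∪ L ∪ C₂` would be a crossing of `Q` inside `O₂`); in
  particular they lie in distinct connected components of `[Q] ∩ O₂`.

No percolation, no named fact.

## References

* O. Schramm, S. Smirnov, Ann. Probab. 39 (2011) 1768–1814, arXiv:1101.5820, §2 (proof of
  Thm. 1.1). [SchrammSmirnov2011]
* K. Kuratowski, *Topology* II (1968), §47.II–III (cut-wire theorem, boundary bumping).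
-/

noncomputable section

open Set Metric
open Literature.Topology.PlaneTopology

namespace Literature.Probability.Percolation

namespace QuadCrossing

/-! ### Boundary bumping for a level set -/

/-- **Boundary bumping.**  Let `K ⊆ ℂ` be compact and connected, `φ : ℂ → ℝ` continuous, `x ∈ K`
with `ρ ≤ φ x`, and suppose `K` meets `{φ < ρ}`.  Then the connected component of `x` in
`K ∩ {ρ ≤ φ}` contains a point of the level set `{φ = ρ}`.  (Otherwise the cut-wire theorem in the
compact space `Z = K ∩ {ρ ≤ φ}` gives a clopen `U ∋ x` of `Z` inside `{ρ < φ}`; such a `U` is clopen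
in `K`, so `U = K` by connectedness — but `K` meets `{φ < ρ}`.) [folklore] -/
theorem exists_mem_connectedComponentIn_level {K : Set ℂ} (hK : IsCompact K) (hKc : IsPreconnected K)
    {φ : ℂ → ℝ} (hφ : Continuous φ) {ρ : ℝ} {x : ℂ} (hx : x ∈ K) (hxρ : ρ ≤ φ x)
    (hlow : ∃ y ∈ K, φ y < ρ) :
    ∃ z ∈ connectedComponentIn (K ∩ {z | ρ ≤ φ z}) x, φ z = ρ := by
  set Z : Set ℂ := K ∩ {z | ρ ≤ φ z} with hZ
  have hZc : IsCompact Z := hK.inter_right (isClosed_le continuous_const hφ)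
  haveI : CompactSpace Z := isCompact_iff_compactSpace.1 hZc
  have hxZ : x ∈ Z := ⟨hx, hxρ⟩
  by_contra hcon
  push Not at hcon
  -- cut-wire in `Z` between `{x}` and the level set
  set x' : Z := ⟨x, hxZ⟩ with hx'
  set B : Set Z := {z | φ (z : ℂ) = ρ} with hB
  have hBc : IsClosed B := isClosed_eq (hφ.comp continuous_subtype_val) continuous_const
  have hdisj : ∀ y ∈ ({x'} : Set Z), Disjoint (connectedComponent y) B := by
    intro y hy
    rw [mem_singleton_iff.1 hy]
    refine Set.disjoint_left.2 fun z hz hzB => hcon z ?_ hzB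
    rw [connectedComponentIn_eq_image hxZ]
    exact ⟨z, hz, rfl⟩
  obtain ⟨U, hU, hxU, hUB⟩ := exists_isClopen_superset_disjoint isClosed_singleton hBc hdisj
  have hxU' : x' ∈ U := hxU (mem_singleton _)
  -- `U` read in the plane
  obtain ⟨O, hO, hOU⟩ := isOpen_induced_iff.1 hU.isOpen
  obtain ⟨O', hO', hO'U⟩ := isOpen_induced_iff.1 hU.compl.isOpen
  have hUφ : ∀ z ∈ U, ρ < φ (z : ℂ) := fun z hz =>
    lt_of_le_of_ne z.2.2 fun h => Set.disjoint_left.1 hUB hz h.symm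
  -- the open sets `u = O ∩ {ρ < φ}` and `v = {φ < ρ} ∪ O'` split `K`
  set u : Set ℂ := O ∩ {z | ρ < φ z} with hu
  set v : Set ℂ := {z | φ z < ρ} ∪ O' with hv
  have huo : IsOpen u := hO.inter (isOpen_lt continuous_const hφ)
  have hvo : IsOpen v := (isOpen_lt hφ continuous_const).union hO'
  have hKu : ∀ z ∈ K, z ∈ u → ∃ hz : z ∈ Z, (⟨z, hz⟩ : Z) ∈ U := by
    rintro z hzK ⟨hzO, hzφ⟩
    have hzφ' : ρ < φ z := hzφ
    refine ⟨⟨hzK, hzφ'.le⟩, ?_⟩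
    rw [← hOU]
    exact hzO
  have hKv : ∀ z ∈ K, z ∈ v → ∀ hz : z ∈ Z, (⟨z, hz⟩ : Z) ∉ U := by
    rintro z hzK (hzφ | hzO') hz hzU
    · exact absurd (hUφ _ hzU) (not_lt.2 (le_of_lt hzφ))
    · have : (⟨z, hz⟩ : Z) ∈ Uᶜ := by rw [← hO'U]; exact hzO'
      exact this hzU
  have hcover : K ⊆ u ∪ v := by
    intro z hzK
    by_cases hzφ : φ z < ρ
    · exact Or.inr (Or.inl hzφ)
    · have hz : z ∈ Z := ⟨hzK, not_lt.1 hzφ⟩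
      by_cases hzU : (⟨z, hz⟩ : Z) ∈ U
      · refine Or.inl ⟨?_, hUφ _ hzU⟩
        have : (⟨z, hz⟩ : Z) ∈ Subtype.val ⁻¹' O := by rw [hOU]; exact hzU
        exact this
      · refine Or.inr (Or.inr ?_)
        have : (⟨z, hz⟩ : Z) ∈ Subtype.val ⁻¹' O' := by rw [hO'U]; exact hzU
        exact this
  obtain ⟨y, hyK, hyφ⟩ := hlow
  have hxO : x ∈ O := by
    have : x' ∈ Subtype.val ⁻¹' O := by rw [hOU]; exact hxU'
    exact this
  obtain ⟨z, hzK, hzu, hzv⟩ := hKc u v huo hvo hcover ⟨x, hx, ⟨hxO, hUφ _ hxU'⟩⟩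
    ⟨y, hyK, Or.inl hyφ⟩
  obtain ⟨hz, hzU⟩ := hKu z hzK hzu
  exact hKv z hzK hzv hz hzU

/-- The connected component of a point in a compact set is compact. [folklore] -/
theorem isCompact_connectedComponentIn {F : Set ℂ} (hF : IsCompact F) (x : ℂ) :
    IsCompact (connectedComponentIn F x) := by
  by_cases hx : x ∈ F
  · haveI : CompactSpace F := isCompact_iff_compactSpace.1 hF
    rw [connectedComponentIn_eq_image hx]
    exact (isClosed_connectedComponent.isCompact).image continuous_subtype_val
  · rw [connectedComponentIn_eq_empty hx]
    exact isCompact_empty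

/-! ### Two arms around a ball from a destroyed crossing -/

namespace Quad

variable {D : Set ℂ}

/-- **Two open arms around a pivotal ball.**  Let `K` be a crossing of the quad `Q`, `w ∈ ℂ`,
`0 < ρ ≤ R`, and `O₂ ⊆ ℂ` a set containing `K ∖ B(w, ρ)` (in the application: `K` lies inside the
open edges of `ω₁`, and `ω₂` agrees with `ω₁` off the edges drawn inside `B(w, ρ)`) such that NO
crossing of `Q` lies inside `O₂` (`ω₂ ∉ ⊞_Q`), the sides `∂₀Q`, `∂₂Q` being at distance `> R` from
`w`.  Then there are two continua `C₀, C₂ ⊆ K ∖ B(w, ρ)` with `C₀ ∩ ∂₀Q ≠ ∅`, `C₂ ∩ ∂₂Q ≠ ∅`, each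
meeting the circle `{|z - w| = ρ}` and the exterior `{|z - w| > R}` — two crossings of the annulus
`A(w; ρ, R)` inside `O₂` — and no continuum `L ⊆ [Q] ∩ O₂` meets both ("in `ω_j` we have the four
arm event from `∂B_j` to `∂Q₀`", in the cluster form: two open arms in distinct open clusters).
Proof: `K` meets `B(w, ρ)` (else `K ⊆ O₂` would cross); `C₀`, `C₂` are the components of the
endpoints `x₀ ∈ ∂₀Q`, `x₂ ∈ ∂₂Q` in `K ∖ B(w, ρ)`, which reach the circle by boundary bumping; a
joining continuum `L` would make `C₀ ∪ L ∪ C₂` a crossing inside `O₂`.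
[cite: SchrammSmirnov2011, §2 (proof of Thm. 1.1)] -/
theorem exists_two_arms_of_isCrossing (Q : Quad D) {K O₂ : Set ℂ} {w : ℂ} {ρ R : ℝ}
    (hK : Q.IsCrossing K) (hKO : K \ ball w ρ ⊆ O₂)
    (hno : ∀ K', Q.IsCrossing K' → ¬K' ⊆ O₂) (hρR : ρ ≤ R)
    (hfar : ∀ z ∈ Q.side 0 ∪ Q.side 2, R < dist z w) :
    ∃ C₀ C₂ : Set ℂ, C₀ ⊆ K \ ball w ρ ∧ C₂ ⊆ K \ ball w ρ ∧
      IsCompact C₀ ∧ IsConnected C₀ ∧ IsCompact C₂ ∧ IsConnected C₂ ∧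
      (C₀ ∩ Q.side 0).Nonempty ∧ (C₂ ∩ Q.side 2).Nonempty ∧
      (∃ z ∈ C₀, dist z w = ρ) ∧ (∃ z ∈ C₀, R < dist z w) ∧
      (∃ z ∈ C₂, dist z w = ρ) ∧ (∃ z ∈ C₂, R < dist z w) ∧
      ∀ L : Set ℂ, IsCompact L → IsConnected L → L ⊆ Q.carrier → L ⊆ O₂ →
        (L ∩ C₀).Nonempty → (L ∩ C₂).Nonempty → False := by
  obtain ⟨hKc, hKconn, hKQ, ⟨x₀, hx₀K, hx₀⟩, ⟨x₂, hx₂K, hx₂⟩⟩ := hK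
  -- `K` meets the ball
  have hmeet : ∃ y ∈ K, dist y w < ρ := by
    by_contra h
    push Not at h
    refine hno K ⟨hKc, hKconn, hKQ, ⟨x₀, hx₀K, hx₀⟩, ⟨x₂, hx₂K, hx₂⟩⟩ fun z hz => hKO ⟨hz, ?_⟩
    rw [mem_ball]
    exact not_lt.2 (h z hz)
  have hφ : Continuous fun z : ℂ => dist z w := continuous_id.dist continuous_const
  set Z : Set ℂ := K ∩ {z | ρ ≤ dist z w} with hZ
  have hZsub : Z ⊆ K \ ball w ρ := fun z hz => ⟨hz.1, fun hb => not_lt.2 hz.2 (mem_ball.1 hb)⟩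
  have hZc : IsCompact Z := hKc.inter_right (isClosed_le continuous_const hφ)
  have hx₀R : R < dist x₀ w := hfar x₀ (Or.inl hx₀)
  have hx₂R : R < dist x₂ w := hfar x₂ (Or.inr hx₂)
  have hx₀Z : x₀ ∈ Z := ⟨hx₀K, hρR.trans hx₀R.le⟩
  have hx₂Z : x₂ ∈ Z := ⟨hx₂K, hρR.trans hx₂R.le⟩
  set C₀ := connectedComponentIn Z x₀ with hC₀
  set C₂ := connectedComponentIn Z x₂ with hC₂
  have hC₀Z : C₀ ⊆ Z := connectedComponentIn_subset _ _
  have hC₂Z : C₂ ⊆ Z := connectedComponentIn_subset _ _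
  have hlow : ∃ y ∈ K, dist y w < ρ := hmeet
  obtain ⟨z₀, hz₀C, hz₀⟩ := exists_mem_connectedComponentIn_level hKc hKconn.isPreconnected hφ
    hx₀K (hρR.trans hx₀R.le) hlow
  obtain ⟨z₂, hz₂C, hz₂⟩ := exists_mem_connectedComponentIn_level hKc hKconn.isPreconnected hφ
    hx₂K (hρR.trans hx₂R.le) hlow
  refine ⟨C₀, C₂, hC₀Z.trans hZsub, hC₂Z.trans hZsub, isCompact_connectedComponentIn hZc x₀,
    isConnected_connectedComponentIn_iff.2 hx₀Z, isCompact_connectedComponentIn hZc x₂,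
    isConnected_connectedComponentIn_iff.2 hx₂Z,
    ⟨x₀, mem_connectedComponentIn hx₀Z, hx₀⟩, ⟨x₂, mem_connectedComponentIn hx₂Z, hx₂⟩,
    ⟨z₀, hz₀C, hz₀⟩, ⟨x₀, mem_connectedComponentIn hx₀Z, hx₀R⟩,
    ⟨z₂, hz₂C, hz₂⟩, ⟨x₂, mem_connectedComponentIn hx₂Z, hx₂R⟩,
    fun L hLc hLconn hLQ hLO hL₀ hL₂ => ?_⟩
  -- a joining continuum would give a crossing inside `O₂`
  have hconn : IsConnected (C₀ ∪ L ∪ C₂) := by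
    refine IsConnected.union ?_ ((isConnected_connectedComponentIn_iff.2 hx₀Z).union ?_ hLconn)
      (isConnected_connectedComponentIn_iff.2 hx₂Z)
    · obtain ⟨y, hyL, hyC⟩ := hL₂
      exact ⟨y, Or.inr hyL, hyC⟩
    · obtain ⟨y, hyL, hyC⟩ := hL₀
      exact ⟨y, hyC, hyL⟩
  refine hno (C₀ ∪ L ∪ C₂) ⟨((isCompact_connectedComponentIn hZc x₀).union hLc).union
    (isCompact_connectedComponentIn hZc x₂), hconn, ?_, ?_, ?_⟩ ?_
  · exact union_subset (union_subset (hC₀Z.trans (inter_subset_left.trans hKQ)) hLQ)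
      (hC₂Z.trans (inter_subset_left.trans hKQ))
  · exact ⟨x₀, Or.inl (Or.inl (mem_connectedComponentIn hx₀Z)), hx₀⟩
  · exact ⟨x₂, Or.inr (mem_connectedComponentIn hx₂Z), hx₂⟩
  · exact union_subset (union_subset ((hC₀Z.trans hZsub).trans hKO) hLO)
      ((hC₂Z.trans hZsub).trans hKO)

end Quad

end QuadCrossing

end Literature.Probability.Percolation

end
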